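import Summits.QuantumFields.GaugeBoot.OneOverNFirstOrderFactorization
import Summits.QuantumFields.GaugeBoot.OneOverNFreeEnergyPrep
import Summits.QuantumFields.GaugeBoot.GaugeStringDuality
import Summits.QuantumFields.GaugeBoot.PlaquetteStringSum
import HarnessLib

/-!
# First-order factorization of the `1/N` expansion — the packaged theorem (gauge-boot, ADDENDUM 30 part S)

HONEST FRAMING (cell `pub-gaugeboot`, page 1 of every file): the venture produces certified bounds
on lattice expectations at stated coupling, gauge group, dimension and torus size; NOT a mass gap,
NOT a continuum limit, NOT a string tension; NOT Yang–Mills-summit-bearing (barriers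
`FixedCouplingUltralocality`, `PerturbativeInvisibility`).  Strong-coupling `SO(N)` lattice gauge theory with free boundary
condition (S. Chatterjee, Comm. Math. Phys. **366** (2019); S. Chatterjee, J. Jafarov, arXiv:1604.04777); nothing about
four-dimensional continuum Yang–Mills or a mass gap.

## Content

★★★ `firstOrder_factorization` — for `d ≥ 2` there is `β₁ = β₁(d) > 0` such that for `|β| ≤ β₁` the coefficients
`f_0 = F 2 β`, `f_1 = F 3 β` of the `1/N` expansion `⟨W_{l₁}⋯W_{lₙ}⟩/Nⁿ = f_0 + f_1/N + o(1/N)` (pinned by the stated limits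
along the cubes `box d N`, and `f_0 = Σ_X w_β(X)` Chatterjee's string sum) satisfy

  `f_0(l₁, …, lₙ) = Πᵢ f_0(lᵢ)`   and   `f_1(l₁, …, lₙ) = Σᵢ f_1(lᵢ) · Π_{j ≠ i} f_0(lⱼ)`

(the second written as the Leibniz fold), in particular `f_1(l₁, l₂) = f_1(l₁) f_0(l₂) + f_0(l₁) f_1(l₂)`: connected
correlations of normalised Wilson loops vanish to first order in `1/N`.  Assembled from the abstract contraction theorem
`firstOrder_factorization_of`, the lane's `oneOverN_master` (equations, a priori bounds, identification) and Chatterjee's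
Corollary 3.2 (`wilsonLoopFactorization_holds`) along the cubes `box d (N²)`.

Everything is `[folklore]` given the siblings.
-/

noncomputable section

open Finset Filter Topology
open Literature.Probability.LatticeModels (Site box)
open Literature.MathematicalPhysics.QuantumLattice (ZdPlaquette)
open Literature.MathematicalPhysics.QuantumFieldTheory (latticeNorm)
open Literature.MathematicalPhysics.QuantumFieldTheory.Chatterjee2019LargeN
open Literature.MathematicalPhysics.QuantumFieldTheory.Chatterjee2019LargeN.CoeffCatalanBoundProof
open Literature.MathematicalPhysics.QuantumFieldTheory.Chatterjee2019LargeN.Word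

namespace Summit.QuantumFields.GaugeBoot

namespace StringDuality

variable {d : ℕ}

/-- The small-`β` regime making the contraction constant `θ ≤ 3/8` for `K ≥ 8`. [folklore] -/
theorem contraction_regime_eighth {K β : ℝ} (hK8 : 8 ≤ K) (hβ : |β| ≤ 1 / (8192 * ((d : ℝ) + 1) * K ^ 4)) :
    2 / K + |β| * (2 * ((2 * (d - 1) : ℕ) : ℝ) * 256 * K ^ 4) ≤ 3 / 8 := by
  have hK0 : 0 < K := by linarith
  set P : ℝ := ((2 * (d - 1) : ℕ) : ℝ) with hPdef
  have hP0 : 0 ≤ P := Nat.cast_nonneg _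
  have hP : P ≤ 2 * ((d : ℝ) + 1) := by
    have h : (2 * (d - 1) : ℕ) ≤ 2 * (d + 1) := by omega
    rw [hPdef]; exact_mod_cast h
  have h1 : 2 / K ≤ 1 / 4 := by rw [div_le_iff₀ hK0]; linarith
  have h2 : |β| * (2 * P * 256 * K ^ 4) ≤ 1 / 8 := by
    calc |β| * (2 * P * 256 * K ^ 4)
        ≤ (1 / (8192 * ((d : ℝ) + 1) * K ^ 4)) * (2 * (2 * ((d : ℝ) + 1)) * 256 * K ^ 4) := by
          apply mul_le_mul hβ _ (by positivity) (by positivity); gcongr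
      _ = 1 / 8 := by field_simp; ring
  linarith

/-- The first component of the Leibniz fold is the product. [folklore] -/
theorem leibnizFold_fst (a b : List (DEdge d) → ℝ) (u : LoopSeq d) :
    (u.foldr (fun l acc => (a l * acc.1, b l * acc.1 + a l * acc.2)) ((1 : ℝ), (0 : ℝ))).1 = (u.map a).prod := by
  induction u with
  | nil => rfl
  | cons l u ih =>
    rw [List.foldr_cons, List.map_cons, List.prod_cons]
    show a l * _ = _
    rw [ih]

/-- The cubes `box d (N²)` exhaust `ℤᵈ`. [folklore] -/
theorem isExhaustion_box_sq : IsExhaustion fun N : ℕ => box d (N * N) := by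
  refine ⟨fun m n hmn => (isExhaustion_box (d := d)).1 (Nat.mul_le_mul hmn hmn), fun x => ?_⟩
  obtain ⟨n, hn⟩ := (isExhaustion_box (d := d)).2 x
  exact ⟨n, (isExhaustion_box (d := d)).1 (Nat.le_mul_self n) hn⟩

variable (d)

/-- ★★★ **First-order factorization of the `1/N` expansion**: for `|β| ≤ β₁(d)` the coefficients `f_0 = F 2 β` and
`f_1 = F 3 β` of `⟨W_{l₁}⋯W_{lₙ}⟩/Nⁿ = f_0 + f_1/N + o(1/N)` (strongly coupled `SO(N)` lattice gauge theory, free boundary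
condition, cubes `box d N`) satisfy `f_0(l₁,…,lₙ) = Π f_0(lᵢ)` and the Leibniz rule
`f_1(l₁,…,lₙ) = Σᵢ f_1(lᵢ) Π_{j≠i} f_0(lⱼ)`; in particular `f_1(l₁,l₂) = f_1(l₁) f_0(l₂) + f_0(l₁) f_1(l₂)`.
[cite: ChatterjeeJafarov2016OneOverN, Theorem 3.1; Chatterjee2019LargeN, Corollary 3.2, Theorem 3.6] [folklore] -/
theorem firstOrder_factorization (hd : 2 ≤ d) :
    ∃ β₁ : ℝ, 0 < β₁ ∧ ∃ F : ℕ → ℝ → LoopSeq d → ℝ,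
      (∀ k, k ≤ 1 → ∀ β : ℝ, |β| ≤ β₁ → ∀ s : LoopSeq d, IsLoopSeq s →
        Tendsto (fun N : ℕ => (N : ℝ) ^ k *
          (phi N β (box d N) s - ∑ i ∈ Finset.range k, F (i + 2) β s / (N : ℝ) ^ i)) atTop (𝓝 (F (k + 2) β s))) ∧
      (∀ β : ℝ, |β| ≤ β₁ → ∀ s : LoopSeq d, IsLoopSeq s → F 2 β s = ∑' X : Trajectory s, X.weight β) ∧
      ∀ β : ℝ, |β| ≤ β₁ →
        (∀ s : LoopSeq d, IsLoopSeq s → F 2 β s = (s.map fun l => F 2 β [l]).prod) ∧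
        (∀ s : LoopSeq d, IsLoopSeq s →
          F 3 β s = (s.foldr (fun l acc => (F 2 β [l] * acc.1, F 3 β [l] * acc.1 + F 2 β [l] * acc.2))
            ((1 : ℝ), (0 : ℝ))).2) ∧
        (∀ l₁ l₂ : List (DEdge d), IsLoopSeq [l₁, l₂] →
          F 3 β [l₁, l₂] = F 3 β [l₁] * F 2 β [l₂] + F 2 β [l₁] * F 3 β [l₂]) := by
  obtain ⟨β₀, hpos, hanti, C, L, hC, hL, F, hF0, hF1, HA, HB, -⟩ := oneOverN_master d hd
  obtain ⟨βW, hβW, HW⟩ := wilsonLoopFactorization_holds d hd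
  set K : ℝ := max 8 ((2 * L 1) ^ 2) with hK
  have hK8 : 8 ≤ K := le_max_left _ _
  have hLK : (2 * L 1) ^ 2 ≤ K := le_max_right _ _
  have hK0 : 0 < K := by linarith
  set βc : ℝ := 1 / (8192 * ((d : ℝ) + 1) * K ^ 4) with hβc
  have hβc0 : 0 < βc := by positivity
  refine ⟨min (β₀ 1) (min βW βc), lt_min (hpos 1) (lt_min hβW hβc0), F, ?_, ?_, ?_⟩
  · intro k hk β hb s hs
    have hb' : |β| ≤ β₀ k := by
      interval_cases k
      · exact (hb.trans (min_le_left _ _)).trans (hanti 0)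
      · exact hb.trans (min_le_left _ _)
    exact (HA k β hb').2.2.2.2.1 s hs
  · intro β hb s hs
    exact HB β ((hb.trans (min_le_left _ _)).trans (hanti 0)) s hs
  intro β hb
  have hb1 : |β| ≤ β₀ 1 := hb.trans (min_le_left _ _)
  have hb0 : |β| ≤ β₀ 0 := hb1.trans (hanti 0)
  have hbW : |β| ≤ βW := (hb.trans (min_le_right _ _)).trans (min_le_left _ _)
  have hbc : |β| ≤ βc := (hb.trans (min_le_right _ _)).trans (min_le_right _ _)
  have hθ : 2 / K + |β| * (2 * ((2 * (d - 1) : ℕ) : ℝ) * 256 * K ^ 4) ≤ 3 / 8 :=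
    contraction_regime_eighth hK8 (by rw [hβc] at hbc; exact hbc)
  have h0nil : F 2 β [] = 1 := by simpa using (HA 0 β hb0).1
  have h1nil : F 3 β [] = 0 := by simpa using (HA 1 β hb1).1
  have hbd : ∀ u : LoopSeq d, IsLoopSeq u → |F 3 β u| ≤ C 1 * L 1 ^ u.len := fun u hu => by
    simpa using (HA 1 β hb1).2.1 u hu
  have hE0 : ∀ u : LoopSeq d, IsLoopSeq u → u ≠ [] →
      (u.len : ℝ) * F 2 β u -
          ((∑ o : InvIdx u, F 2 β (u.negSplitAt o)) - (∑ o : SameIdx u, F 2 β (u.posSplitAt o))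
            + β * (∑ o : DeformIdx u, F 2 β (u.negDeformAt o)) - β * (∑ o : DeformIdx u, F 2 β (u.posDeformAt o))) = 0 := by
    intro u hu hne
    simpa [hF0, hF1] using (HA 0 β hb0).2.2.1 u hu hne
  have hE1 : ∀ u : LoopSeq d, IsLoopSeq u → u ≠ [] →
      (u.len : ℝ) * F 3 β u -
          ((∑ o : InvIdx u, F 3 β (u.negSplitAt o)) - (∑ o : SameIdx u, F 3 β (u.posSplitAt o))
            + β * (∑ o : DeformIdx u, F 3 β (u.negDeformAt o)) - β * (∑ o : DeformIdx u, F 3 β (u.posDeformAt o))) =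
        (u.len : ℝ) * F 2 β u + ((∑ o : SameIdx u, F 2 β (u.negTwistAt o)) - ∑ o : InvIdx u, F 2 β (u.posTwistAt o)) := by
    intro u hu hne
    simpa [hF1] using (HA 1 β hb1).2.2.1 u hu hne
  -- convergence of `φ_N` to `f_0` along the cubes `box d (N²)`
  have hconv : ∀ t : LoopSeq d, IsLoopSeq t →
      Tendsto (fun N : ℕ => phi N β (box d (N * N)) t) atTop (𝓝 (F 2 β t)) := by
    intro t ht
    simpa using (HA 0 β hb0).2.2.2.1 (fun N => N * N) superlog_sq t ht
  have hsing : ∀ l : List (DEdge d), IsLoop l → l ≠ [] → IsLoopSeq [l] := by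
    intro l hl hne l' hl'
    rw [List.mem_singleton] at hl'
    rw [hl']; exact ⟨hl, hne⟩
  have ha1 : ∀ l : List (DEdge d), IsLoop l → l ≠ [] → |F 2 β [l]| ≤ 1 := fun l hl hne =>
    le_of_tendsto' ((hconv [l] (hsing l hl hne)).abs) (fun N => abs_phi_le_one N β _ [l])
  -- multiplicativity of `f_0` (Chatterjee's Corollary 3.2 transported to the cubes `box d (N²)`)
  have hmul : ∀ u : LoopSeq d, IsLoopSeq u →
      F 2 β u = (u.foldr (fun l acc => (F 2 β [l] * acc.1, F 3 β [l] * acc.1 + F 2 β [l] * acc.2))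
        ((1 : ℝ), (0 : ℝ))).1 := by
    intro u hu
    rw [leibnizFold_fst]
    by_cases hne : u = []
    · subst hne; simpa using h0nil
    obtain ⟨Lf, hLi, hprod⟩ := HW (fun N => box d (N * N)) isExhaustion_box_sq β hbW u hu hne
    have hLi' : ∀ i, Lf i = F 2 β [u.get i] := fun i =>
      tendsto_nhds_unique (hLi i)
        (hconv [u.get i] (hsing _ (hu _ (List.get_mem u i)).1 (hu _ (List.get_mem u i)).2))
    rw [← List.ofFn_getElem_eq_map, List.prod_ofFn, tendsto_nhds_unique (hconv u hu) hprod]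
    exact Finset.prod_congr rfl fun i _ => hLi' i
  have hzero := firstOrder_factorization_of (β := β) (K := K) (C₁ := C 1) (L₁ := L 1)
    (f0 := F 2 β) (f1 := F 3 β)
    (P := fun u => (u.foldr (fun l acc => (F 2 β [l] * acc.1, F 3 β [l] * acc.1 + F 2 β [l] * acc.2))
      ((1 : ℝ), (0 : ℝ))).1)
    (Q := fun u => (u.foldr (fun l acc => (F 2 β [l] * acc.1, F 3 β [l] * acc.1 + F 2 β [l] * acc.2))
      ((1 : ℝ), (0 : ℝ))).2)
    (G := fun u => F 3 β u - (u.foldr (fun l acc => (F 2 β [l] * acc.1, F 3 β [l] * acc.1 + F 2 β [l] * acc.2))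
      ((1 : ℝ), (0 : ℝ))).2)
    hK8 hθ (hC 1) (hL 1) hLK h0nil h1nil rfl (fun _ _ => rfl) rfl (fun _ _ => rfl) (fun _ => rfl) hmul ha1 hbd hE0 hE1
  have hfac : ∀ s : LoopSeq d, IsLoopSeq s →
      F 3 β s = (s.foldr (fun l acc => (F 2 β [l] * acc.1, F 3 β [l] * acc.1 + F 2 β [l] * acc.2))
        ((1 : ℝ), (0 : ℝ))).2 := fun s hs => sub_eq_zero.1 (hzero s hs)
  refine ⟨fun s hs => by rw [hmul s hs, leibnizFold_fst], hfac, fun l₁ l₂ h12 => ?_⟩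
  rw [hfac [l₁, l₂] h12]
  simp only [List.foldr_cons, List.foldr_nil]
  ring

end StringDuality

end Summit.QuantumFields.GaugeBoot

end
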